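import Summits.AtomisticToContinuum.HydrodynamicLimit.Theorems.CollisionIsometryCLTAdaptedWeightCLTCBFreeStretch

/-!
# Stub `stub_pathwiseBudget` of the line `Sketch` (contact-balance composition) for the crux
`AdaptedWeightCLT` (stmt-AtomisticToContinuum-14868; `--supports`)

FREE-STRETCH BOUND ⇒ PATHWISE PRODUCTION BUDGET along good orbits
(`FreeStretchBound γ φ σ →` for `N ≥ N₀`, every flow `Φ`, `t ≥ 0`, `z ∈ Φ.good`:
`prodColl ≤ anis(Φ_0 z) + K (N+1)^γ √(∫₀ᵗ (1 + v_max)⁸) √(∫₀ᵗ anis)`).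

* ONE STRETCH (`PathwiseBudget.stretch`). On a collision-free interval `(a, b)` of a hard-sphere
  trajectory `γ` the curve is the free flight of `γ a` (`IsHardSphereTrajectory.eq_freeFlight_of_Ioo_free`),
  its left limit at `b` is the free-flight value (`leftLim_eq_freeFlight`), the whole stretch stays in
  the hard-sphere domain (`mem`, `leftLim_mem`); the collision pair sum over `(a, b]` of the
  production summand is either `0` (no collision at `b`; then `γ b` is the free-flight value) or
  `anis(leftLim γ b) − anis(γ b)` (one ordered contact pair with `i < j`, `contactPairs_eq_pair`,
  `leftLim_eq_collidePair`: `PathwiseBudget.sum_contactPairs_prod`). In both cases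
  `Σ_{(a,b]} + anis(γ b) − anis(γ a) = anis(freeFlight (b − a) (γ a)) − anis(γ a)`, which the hypothesis
  bounds by `L (1 + v_max(γ a))⁴ ∫₀^{b−a} √anis(freeFlight r (γ a)) dr = L ∫ₐᵇ (1 + v_max(γ s))⁴ √anis(γ s) ds`
  (free flight keeps the velocities; translation of the time variable; the endpoint is null).
* TELESCOPING (`PathwiseBudget.budget`): strong induction on the number of collision times in
  `(0, t)`, splitting `(0, t]` at the last one (`collisionPairSum_union`,
  `integral_add_adjacent_intervals`): `Σ_{(0,t]} + anis(γ t) ≤ anis(γ 0) + L ∫₀ᵗ (1 + v_max)⁴ √anis`.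
* INTEGRABILITY on good orbits: `s ↦ anis(Φ_s z) = ∫ₓ DefectSq` is integrable on `[0, t]`
  (`Reduction.integrable_of_bdd`: jointly measurable and bounded), `v_max(Φ_s z) ≤ vR z` is a
  continuous function of the measurable orbit; CAUCHY–SCHWARZ in time gives
  `∫₀ᵗ (1+v_max)⁴ √anis ≤ √vmaxInt √Xint`, and `anis(γ t) ≥ 0` is dropped. The constant is `max K 0`
  and `N₀` that of the hypothesis.
-/

namespace Summit.AtomisticToContinuum.HydrodynamicLimit.Theorems.ContactBalance

open scoped BigOperators Topology Classical MeasureTheory ENNReal InnerProductSpace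
open Filter Set MeasureTheory
open Literature.Analysis.FluidPDE
open Summit.AtomisticToContinuum.HydrodynamicLimit.Theorems.ContactSourceDuhamel
open Summit.AtomisticToContinuum.HydrodynamicLimit.Theorems.ContactSourceDuhamel.TimeLocal
open Literature.MathematicalPhysics.KineticTheory (hsDiameter hsDiameter_le)

noncomputable section

namespace PathwiseBudget

variable {γ C : ℝ} {φ : ℕ → T3 → ℝ} {σ : ℝ} {N : ℕ}

/-! ## The maximal speed along a good orbit -/

/-- `v_max` is a continuous function of the configuration. -/
theorem continuous_vmax (N : ℕ) : Continuous (vmax N) := by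
  show Continuous fun w : Cfg N => Finset.univ.sup' Finset.univ_nonempty fun i => ‖(w i).2‖
  exact Continuous.finset_sup'_apply _ fun i _ => ((continuous_apply i).snd).norm

/-- `0 ≤ v_max`. -/
theorem vmax_nonneg (w : Cfg N) : 0 ≤ vmax N w :=
  (norm_nonneg _).trans (Finset.le_sup' (fun i => ‖(w i).2‖) (Finset.mem_univ 0))

/-- Along a good orbit `v_max(Φ_s z) ≤ vR z` (conservation of the kinetic energy). -/
theorem vmax_flow_le (Φ : Flow σ N) {z : Cfg N} (hz : z ∈ Φ.good) (s : ℝ) :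
    vmax N (Φ.flow s z) ≤ Reduction.vR z :=
  Finset.sup'_le _ _ fun i _ => Reduction.norm_vel_flow_le Φ hz s i

/-- `‖(1 + v_max(Φ_s z))⁴‖ ≤ (1 + vR z)⁴` along a good orbit. -/
theorem norm_vmax4_flow_le (Φ : Flow σ N) {z : Cfg N} (hz : z ∈ Φ.good) (s : ℝ) :
    ‖(1 + vmax N (Φ.flow s z)) ^ 4‖ ≤ (1 + Reduction.vR z) ^ 4 := by
  rw [Real.norm_eq_abs, abs_of_nonneg (pow_nonneg (add_nonneg zero_le_one (vmax_nonneg _)) 4)]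
  exact pow_le_pow_left₀ (add_nonneg zero_le_one (vmax_nonneg _))
    (add_le_add le_rfl (vmax_flow_le Φ hz s)) 4

/-- `s ↦ (1 + v_max(Φ_s z))⁴` is measurable along a good orbit. -/
theorem measurable_vmax4_flow (Φ : Flow σ N) {z : Cfg N} (hz : z ∈ Φ.good) :
    Measurable fun s => (1 + vmax N (Φ.flow s z)) ^ 4 :=
  (((continuous_vmax N).measurable.comp
    (Reduction.measurable_flow_of_mem_good Φ hz)).const_add 1).pow_const 4

/-- `s ↦ (1 + v_max(Φ_s z))⁴` is square integrable on `[0, t]` along a good orbit. -/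
theorem memLp_vmax4_flow (Φ : Flow σ N) {z : Cfg N} (hz : z ∈ Φ.good) (t : ℝ) :
    MemLp (fun s => (1 + vmax N (Φ.flow s z)) ^ 4) 2 (volume.restrict (Icc 0 t)) :=
  MemLp.of_bound (measurable_vmax4_flow Φ hz).aestronglyMeasurable _
    (ae_of_all _ (norm_vmax4_flow_le Φ hz))

/-! ## Integrability along a good orbit and Cauchy–Schwarz in time -/

/-- `prodColl` is the collision pair sum over `(0, t]` along the orbit of the production summand
(definitional unfolding of `HardSphereFlow.collisionPairSum`). -/
theorem prodColl_eq (Φ : Flow σ N) (φ : ℕ → T3 → ℝ) (t : ℝ) (z : Cfg N) :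
    prodColl σ N Φ φ t z = collisionPairSum (Torus.geometry (Fin 3)) (hsDiameter σ N)
      (fun u => Φ.flow u z) (Ioc 0 t) (fun s i j => if i < j then
        anisC N φ (collidePair (Torus.geometry (Fin 3)) i j (Φ.flow s z)) - anisC N φ (Φ.flow s z)
        else 0) := rfl

/-- `s ↦ anis(Φ_s z) = ∫ₓ DefectSq` is integrable on `[0, t]` along a good orbit (jointly measurable and
bounded integrand). -/
theorem integrableOn_anisC_flow (hadm : AdmissibleKernel γ C φ) (Φ : Flow σ N) {z : Cfg N}
    (hz : z ∈ Φ.good) (t : ℝ) : IntegrableOn (fun s => anisC N φ (Φ.flow s z)) (Icc 0 t) :=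
  (Reduction.integrable_of_bdd t (fun s x => DefectSq σ N Φ φ s z x)
    (Reduction.measurable_defectSq hz (hadm.1 N).continuous)
    (Reduction.bdd_defectSq hz (hadm.2.1 N) (hadm.2.2.2.2.1 N))).2

/-- The square root of a nonnegative integrable function is square integrable. -/
theorem memLp_two_sqrt {α : Type*} [MeasurableSpace α] {μ : Measure α} {g : α → ℝ}
    (hg : Integrable g μ) (h0 : ∀ x, 0 ≤ g x) : MemLp (fun x => Real.sqrt (g x)) 2 μ := by
  have hm : AEStronglyMeasurable (fun x => Real.sqrt (g x)) μ :=
    (Real.continuous_sqrt.measurable.comp_aemeasurable hg.aemeasurable).aestronglyMeasurable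
  exact (memLp_two_iff_integrable_sq hm).2
    (hg.congr (ae_of_all _ fun x => (Real.sq_sqrt (h0 x)).symm))

/-- The reassembled stretch integrand `(1 + v_max(Φ_s z))⁴ √anis(Φ_s z)` of a good orbit is integrable
on `[0, t]`. -/
theorem integrableOn_orbF (hadm : AdmissibleKernel γ C φ) (Φ : Flow σ N) {z : Cfg N}
    (hz : z ∈ Φ.good) (t : ℝ) :
    IntegrableOn (fun s => (1 + vmax N (Φ.flow s z)) ^ 4 * Real.sqrt (anisC N φ (Φ.flow s z)))
      (Icc 0 t) := by
  have h1 : Integrable (fun s => Real.sqrt (anisC N φ (Φ.flow s z))) (volume.restrict (Icc 0 t)) :=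
    (memLp_two_sqrt (integrableOn_anisC_flow hadm Φ hz t)
      fun s => FreeStretch.anisC_nonneg φ _).integrable one_le_two
  exact h1.bdd_mul (memLp_vmax4_flow Φ hz t).1 (ae_of_all _ (norm_vmax4_flow_le Φ hz))

/-- Hence it is interval integrable on every `[a, b]`, `0 ≤ a ≤ b`. -/
theorem intervalIntegrable_orbF (hadm : AdmissibleKernel γ C φ) (Φ : Flow σ N) {z : Cfg N}
    (hz : z ∈ Φ.good) {a b : ℝ} (ha : 0 ≤ a) (hab : a ≤ b) :
    IntervalIntegrable (fun s => (1 + vmax N (Φ.flow s z)) ^ 4 * Real.sqrt (anisC N φ (Φ.flow s z)))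
      volume a b := by
  have h : IntegrableOn (fun s => (1 + vmax N (Φ.flow s z)) ^ 4 *
      Real.sqrt (anisC N φ (Φ.flow s z))) (uIcc a b) := by
    rw [uIcc_of_le hab]
    exact (integrableOn_orbF hadm Φ hz b).mono_set (Icc_subset_Icc ha le_rfl)
  exact h.intervalIntegrable

/-- CAUCHY–SCHWARZ in time: `∫₀ᵗ (1 + v_max)⁴ √anis ≤ √(∫₀ᵗ (1 + v_max)⁸) √(∫₀ᵗ anis) = √vmaxInt √Xint`. -/
theorem integral_orbF_le (hadm : AdmissibleKernel γ C φ) (Φ : Flow σ N) {z : Cfg N}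
    (hz : z ∈ Φ.good) (t : ℝ) :
    ∫ s in Icc 0 t, (1 + vmax N (Φ.flow s z)) ^ 4 * Real.sqrt (anisC N φ (Φ.flow s z)) ≤
      Real.sqrt (vmaxInt σ N Φ t z) * Real.sqrt (Xint σ N Φ φ t z) := by
  have hf := memLp_vmax4_flow Φ hz t
  have hg := memLp_two_sqrt (integrableOn_anisC_flow hadm Φ hz t)
    fun s => FreeStretch.anisC_nonneg φ _
  have h := FreeStretch.integral_mul_le_sqrt_mul_sqrt (μ := volume.restrict (Icc 0 t))
    (f := fun s => (1 + vmax N (Φ.flow s z)) ^ 4) (g := fun s => Real.sqrt (anisC N φ (Φ.flow s z)))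
    (fun s => pow_nonneg (add_nonneg zero_le_one (vmax_nonneg _)) 4) (fun s => Real.sqrt_nonneg _) hf hg
  have e1 : ∫ s in Icc 0 t, ((1 + vmax N (Φ.flow s z)) ^ 4) ^ 2 = vmaxInt σ N Φ t z := by
    unfold vmaxInt
    refine integral_congr_ae (ae_of_all _ fun s => ?_)
    show ((1 + vmax N (Φ.flow s z)) ^ 4) ^ 2 = (1 + vmax N (Φ.flow s z)) ^ 8
    ring
  have e2 : ∫ s in Icc 0 t, Real.sqrt (anisC N φ (Φ.flow s z)) ^ 2 = Xint σ N Φ φ t z := by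
    rw [xint_eq]
    exact integral_congr_ae (ae_of_all _ fun s => Real.sq_sqrt (FreeStretch.anisC_nonneg φ _))
  rw [e1, e2] at h
  exact h

/-! ## One free stretch of a hard-sphere trajectory -/

/-- The torus geometry is regular at the diameter `hsDiameter σ N ≤ σ < 1/2`. -/
theorem regular (hσ : 0 < σ) (hσ2 : σ < 2⁻¹) (N : ℕ) :
    (Torus.geometry (Fin 3)).IsHardSphereRegular (hsDiameter σ N) :=
  Torus.isHardSphereRegular_geometry ((hsDiameter_le hσ.le N).trans_lt hσ2)

/-- Translations of the torus geometry are continuous. -/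
theorem continuous_translate_T3 (hσ : 0 < σ) (hσ2 : σ < 2⁻¹) (N : ℕ) (x : T3) :
    Continuous ((Torus.geometry (Fin 3)).translate x) :=
  (regular hσ hσ2 N).continuous_translate.comp
    (Continuous.prodMk continuous_const continuous_id : Continuous fun v : V3 => (x, v))

/-- THE PRODUCTION AT ONE COLLISION TIME: the sum over the ordered contact pairs of the production summand
(`anis(collidePair i j (γ t)) − anis(γ t)` on `i < j`, `0` otherwise) is `anis(leftLim γ t) − anis(γ t)`
(exactly the two orders of one pair are in contact, `contactPairs_eq_pair`; the pre-collisional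
configuration is the left limit, `leftLim_eq_collidePair`). -/
theorem sum_contactPairs_prod (hσ : 0 < σ) (hσ2 : σ < 2⁻¹) {γo : ℝ → Cfg N}
    (htraj : IsHardSphereTrajectory (Torus.geometry (Fin 3)) (hsDiameter σ N) (N + 1) γo) {t : ℝ}
    (ht : t ∈ collisionTimes (Torus.geometry (Fin 3)) (hsDiameter σ N) γo) :
    ∑ p ∈ contactPairs (Torus.geometry (Fin 3)) (hsDiameter σ N) (γo t),
        (if p.1 < p.2 then anisC N φ (collidePair (Torus.geometry (Fin 3)) p.1 p.2 (γo t)) - anisC N φ (γo t)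
          else 0) = anisC N φ (Function.leftLim γo t) - anisC N φ (γo t) := by
  have hG := regular hσ hσ2 N
  obtain ⟨⟨p₀, q₀⟩, hpq₀⟩ := mem_collisionTimes_iff_contactPairs_nonempty.1 ht
  obtain ⟨p, q, hlt, hpq⟩ : ∃ p q : Fin (N + 1), p < q ∧
      (p, q) ∈ contactPairs (Torus.geometry (Fin 3)) (hsDiameter σ N) (γo t) := by
    rcases lt_or_gt_of_ne (mem_contactPairs.1 hpq₀).1 with h | h
    · exact ⟨p₀, q₀, h, hpq₀⟩
    · exact ⟨q₀, p₀, h, (swap_mem_contactPairs_iff hG (p := (p₀, q₀))).2 hpq₀⟩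
  have hne : (p, q) ≠ (q, p) := fun h => (ne_of_lt hlt) (Prod.mk.inj h).1
  rw [htraj.contactPairs_eq_pair hG hpq, Finset.sum_pair hne]
  simp only [if_pos hlt, if_neg (not_lt.2 hlt.le), add_zero]
  rw [htraj.leftLim_eq_collidePair (i := p) (j := q) (ne_of_lt hlt) (mem_contactPairs.1 hpq).2]

/-- ONE STRETCH. On a collision-free `(a, b)` the collision pair sum over `(a, b]` of a summand whose
contact-pair sum at every collision time is `anis(leftLim) − anis(value)`, plus the increment
`anis(γ b) − anis(γ a)`, equals `anis(freeFlight (b − a) (γ a)) − anis(γ a)` (no collision at `b`: `γ b` is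
the free-flight value and the sum is empty; a collision at `b`: the sum is `anis(leftLim γ b) − anis(γ b)`
and `leftLim γ b` is the free-flight value), which the stretch hypothesis bounds by
`L ∫ₐᵇ (1 + v_max(γ s))⁴ √anis(γ s) ds` (free flight keeps `v_max`; the endpoint `b` is null; translation of
the time variable). -/
theorem stretch (hσ : 0 < σ) (hσ2 : σ < 2⁻¹) {γo : ℝ → Cfg N}
    (htraj : IsHardSphereTrajectory (Torus.geometry (Fin 3)) (hsDiameter σ N) (N + 1) γo)
    {g : ℝ → Fin (N + 1) → Fin (N + 1) → ℝ}
    (hg : ∀ t ∈ collisionTimes (Torus.geometry (Fin 3)) (hsDiameter σ N) γo,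
      ∑ p ∈ contactPairs (Torus.geometry (Fin 3)) (hsDiameter σ N) (γo t), g t p.1 p.2 =
        anisC N φ (Function.leftLim γo t) - anisC N φ (γo t))
    {L : ℝ}
    (hK : ∀ (w : Cfg N) (T : ℝ), 0 ≤ T →
      (∀ r ∈ Icc 0 T, freeFlight (Torus.geometry (Fin 3)) r w ∈
        hardSphereDomain (Torus.geometry (Fin 3)) (N + 1) (hsDiameter σ N)) →
      anisC N φ (freeFlight (Torus.geometry (Fin 3)) T w) - anisC N φ w ≤
        L * (1 + vmax N w) ^ 4 *
          ∫ r in Icc 0 T, Real.sqrt (anisC N φ (freeFlight (Torus.geometry (Fin 3)) r w)))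
    {a b : ℝ} (hab : a ≤ b)
    (hfree : ∀ τ ∈ Ioo a b, τ ∉ collisionTimes (Torus.geometry (Fin 3)) (hsDiameter σ N) γo) :
    collisionPairSum (Torus.geometry (Fin 3)) (hsDiameter σ N) γo (Ioc a b) g +
        anisC N φ (γo b) - anisC N φ (γo a) ≤
      L * ∫ s in a..b, (1 + vmax N (γo s)) ^ 4 * Real.sqrt (anisC N φ (γo s)) := by
  have hGc := continuous_translate_T3 hσ hσ2 N
  rcases hab.eq_or_lt with rfl | hab'
  · rw [intervalIntegral.integral_same, mul_zero, Set.Ioc_self, collisionPairSum_empty]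
    simp
  -- free flight on `[a, b)`, the left limit at `b`, the stretch stays in the domain
  have hFF : ∀ r ∈ Ico 0 (b - a), γo (a + r) = freeFlight (Torus.geometry (Fin 3)) r (γo a) := by
    intro r hr
    have h := htraj.eq_freeFlight_of_Ioo_free hfree (τ := a + r)
      ⟨by linarith [hr.1], by linarith [hr.2]⟩
    rwa [add_sub_cancel_left] at h
  have hlim : Function.leftLim γo b = freeFlight (Torus.geometry (Fin 3)) (b - a) (γo a) :=
    htraj.leftLim_eq_freeFlight hGc hab' hfree
  have hdom : ∀ r ∈ Icc 0 (b - a), freeFlight (Torus.geometry (Fin 3)) r (γo a) ∈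
      hardSphereDomain (Torus.geometry (Fin 3)) (N + 1) (hsDiameter σ N) := by
    intro r hr
    rcases hr.2.eq_or_lt with h | hlt
    · rw [h, ← hlim]
      exact htraj.leftLim_mem hGc b
    · rw [← hFF r ⟨hr.1, hlt⟩]
      exact htraj.mem _
  -- the stretch bound, reassembled along the orbit
  have hkey : anisC N φ (freeFlight (Torus.geometry (Fin 3)) (b - a) (γo a)) - anisC N φ (γo a) ≤
      L * ∫ s in a..b, (1 + vmax N (γo s)) ^ 4 * Real.sqrt (anisC N φ (γo s)) := by
    refine (hK _ _ (sub_nonneg.2 hab) hdom).trans (le_of_eq ?_)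
    rw [mul_assoc]
    congr 1
    have e : ∫ s in a..b, (1 + vmax N (γo s)) ^ 4 * Real.sqrt (anisC N φ (γo s)) =
        ∫ r in (0 : ℝ)..(b - a), (1 + vmax N (γo (a + r))) ^ 4 * Real.sqrt (anisC N φ (γo (a + r))) := by
      rw [intervalIntegral.integral_comp_add_left
        (fun s => (1 + vmax N (γo s)) ^ 4 * Real.sqrt (anisC N φ (γo s))) a, add_zero, add_sub_cancel]
    rw [e, integral_Icc_eq_integral_Ioc, ← intervalIntegral.integral_of_le (sub_nonneg.2 hab),
      ← intervalIntegral.integral_const_mul, intervalIntegral.integral_of_le (sub_nonneg.2 hab),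
      intervalIntegral.integral_of_le (sub_nonneg.2 hab), integral_Ioc_eq_integral_Ioo,
      integral_Ioc_eq_integral_Ioo]
    refine setIntegral_congr_fun measurableSet_Ioo fun r hr => ?_
    have hv : vmax N (freeFlight (Torus.geometry (Fin 3)) r (γo a)) = vmax N (γo a) := rfl
    show (1 + vmax N (γo a)) ^ 4 * Real.sqrt (anisC N φ (freeFlight (Torus.geometry (Fin 3)) r (γo a))) =
      (1 + vmax N (γo (a + r))) ^ 4 * Real.sqrt (anisC N φ (γo (a + r)))
    rw [hFF r ⟨hr.1.le, hr.2⟩, hv]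
  by_cases hb : b ∈ collisionTimes (Torus.geometry (Fin 3)) (hsDiameter σ N) γo
  · -- a collision at `b`: the production there is `anis(leftLim γ b) − anis(γ b)`
    have hset : collisionTimes (Torus.geometry (Fin 3)) (hsDiameter σ N) γo ∩ Ioc a b = {b} := by
      ext τ
      simp only [mem_inter_iff, mem_Ioc, mem_singleton_iff]
      refine ⟨fun h => ?_, fun h => ?_⟩
      · by_contra hne
        exact hfree τ ⟨h.2.1, lt_of_le_of_ne h.2.2 hne⟩ h.1
      · subst h
        exact ⟨hb, hab', le_rfl⟩
    have hsum : collisionPairSum (Torus.geometry (Fin 3)) (hsDiameter σ N) γo (Ioc a b) g =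
        anisC N φ (Function.leftLim γo b) - anisC N φ (γo b) := by
      rw [collisionPairSum, hset, finsum_mem_singleton, hg b hb]
    rw [hsum, hlim]
    linarith [hkey]
  · -- no collision at `b`: no production on `(a, b]`, `γ b` is the free-flight value
    have hnoc : ∀ τ ∈ Ioc a b, τ ∉ collisionTimes (Torus.geometry (Fin 3)) (hsDiameter σ N) γo := by
      intro τ hτ
      rcases hτ.2.eq_or_lt with h | hlt
      · rw [h]
        exact hb
      · exact hfree τ ⟨hτ.1, hlt⟩
    rw [collisionPairSum_eq_zero_of_forall_not_mem hnoc, htraj.free a b hab hnoc]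
    linarith [hkey]

/-! ## Telescoping along the trajectory -/

/-- TELESCOPING (strong induction on the number of collision times in `(0, t)`, splitting `(0, t]` at the
last one): `Σ_{(0,t]} production + anis(γ t) ≤ anis(γ 0) + L ∫₀ᵗ (1 + v_max(γ s))⁴ √anis(γ s) ds`. -/
theorem budget (hσ : 0 < σ) (hσ2 : σ < 2⁻¹) {γo : ℝ → Cfg N}
    (htraj : IsHardSphereTrajectory (Torus.geometry (Fin 3)) (hsDiameter σ N) (N + 1) γo)
    {g : ℝ → Fin (N + 1) → Fin (N + 1) → ℝ}
    (hg : ∀ t ∈ collisionTimes (Torus.geometry (Fin 3)) (hsDiameter σ N) γo,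
      ∑ p ∈ contactPairs (Torus.geometry (Fin 3)) (hsDiameter σ N) (γo t), g t p.1 p.2 =
        anisC N φ (Function.leftLim γo t) - anisC N φ (γo t))
    {L : ℝ}
    (hK : ∀ (w : Cfg N) (T : ℝ), 0 ≤ T →
      (∀ r ∈ Icc 0 T, freeFlight (Torus.geometry (Fin 3)) r w ∈
        hardSphereDomain (Torus.geometry (Fin 3)) (N + 1) (hsDiameter σ N)) →
      anisC N φ (freeFlight (Torus.geometry (Fin 3)) T w) - anisC N φ w ≤
        L * (1 + vmax N w) ^ 4 *
          ∫ r in Icc 0 T, Real.sqrt (anisC N φ (freeFlight (Torus.geometry (Fin 3)) r w)))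
    (hii : ∀ a b : ℝ, 0 ≤ a → a ≤ b →
      IntervalIntegrable (fun s => (1 + vmax N (γo s)) ^ 4 * Real.sqrt (anisC N φ (γo s))) volume a b) :
    ∀ (n : ℕ) (t : ℝ), 0 ≤ t →
      (collisionTimes (Torus.geometry (Fin 3)) (hsDiameter σ N) γo ∩ Ioo 0 t).ncard = n →
      collisionPairSum (Torus.geometry (Fin 3)) (hsDiameter σ N) γo (Ioc 0 t) g + anisC N φ (γo t) ≤
        anisC N φ (γo 0) + L * ∫ s in (0 : ℝ)..t, (1 + vmax N (γo s)) ^ 4 * Real.sqrt (anisC N φ (γo s)) := by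
  intro n
  refine Nat.strong_induction_on n fun n ih => ?_
  intro t ht hn
  by_cases hemp : collisionTimes (Torus.geometry (Fin 3)) (hsDiameter σ N) γo ∩ Ioo 0 t = ∅
  · have hfree : ∀ τ ∈ Ioo 0 t, τ ∉ collisionTimes (Torus.geometry (Fin 3)) (hsDiameter σ N) γo :=
      fun τ hτ hc => (Set.eq_empty_iff_forall_notMem.1 hemp τ) ⟨hc, hτ⟩
    have h := stretch hσ hσ2 htraj hg hK ht hfree
    linarith
  · have hfin : (collisionTimes (Torus.geometry (Fin 3)) (hsDiameter σ N) γo ∩ Ioo 0 t).Finite :=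
      htraj.finite_collisionTimes_inter_of_subset_Icc Ioo_subset_Icc_self
    obtain ⟨s, hs, hmax⟩ := Set.exists_max_image _ id hfin (Set.nonempty_iff_ne_empty.2 hemp)
    have hs0 : 0 < s := hs.2.1
    have hst : s < t := hs.2.2
    have hfree : ∀ τ ∈ Ioo s t, τ ∉ collisionTimes (Torus.geometry (Fin 3)) (hsDiameter σ N) γo :=
      fun τ hτ hc => (not_le.2 hτ.1) (hmax τ ⟨hc, hs0.trans hτ.1, hτ.2⟩)
    have hsub : collisionTimes (Torus.geometry (Fin 3)) (hsDiameter σ N) γo ∩ Ioo 0 s ⊂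
        collisionTimes (Torus.geometry (Fin 3)) (hsDiameter σ N) γo ∩ Ioo 0 t := by
      rw [Set.ssubset_def]
      exact ⟨fun τ hτ => ⟨hτ.1, hτ.2.1, hτ.2.2.trans hst⟩, fun h => (lt_irrefl s) (h hs).2.2⟩
    have hlt : (collisionTimes (Torus.geometry (Fin 3)) (hsDiameter σ N) γo ∩ Ioo 0 s).ncard < n :=
      (Set.ncard_lt_ncard hsub hfin).trans_eq hn
    have ih' := ih _ hlt s hs0.le rfl
    have hstr := stretch hσ hσ2 htraj hg hK hst.le hfree
    have hunion : collisionPairSum (Torus.geometry (Fin 3)) (hsDiameter σ N) γo (Ioc 0 t) g =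
        collisionPairSum (Torus.geometry (Fin 3)) (hsDiameter σ N) γo (Ioc 0 s) g +
          collisionPairSum (Torus.geometry (Fin 3)) (hsDiameter σ N) γo (Ioc s t) g := by
      rw [← Set.Ioc_union_Ioc_eq_Ioc hs0.le hst.le]
      exact collisionPairSum_union (htraj.finite_collisionTimes_inter_of_subset_Icc Ioc_subset_Icc_self)
        (htraj.finite_collisionTimes_inter_of_subset_Icc Ioc_subset_Icc_self)
        (Set.Ioc_disjoint_Ioc_of_le le_rfl) _
    have hint : ∫ x in (0 : ℝ)..t, (1 + vmax N (γo x)) ^ 4 * Real.sqrt (anisC N φ (γo x)) =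
        (∫ x in (0 : ℝ)..s, (1 + vmax N (γo x)) ^ 4 * Real.sqrt (anisC N φ (γo x))) +
          ∫ x in s..t, (1 + vmax N (γo x)) ^ 4 * Real.sqrt (anisC N φ (γo x)) :=
      (intervalIntegral.integral_add_adjacent_intervals (hii 0 s le_rfl hs0.le)
        (hii s t hs0.le hst.le)).symm
    rw [hunion, hint, mul_add]
    linarith [ih', hstr]

end PathwiseBudget

open PathwiseBudget FreeStretch in
/-- STUB 4 (pathwise production budget along good orbits). Enumerate the finitely many collision times
of the orbit in `(0, t)` (`IsHardSphereTrajectory.locFinite`); in between the orbit is a free flight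
staying in the hard-sphere domain, at a collision time the value is `collidePair` of the left limit
`= freeFlight` of the previous value (one ordered contact pair with `i < j` in the regular torus geometry),
so `prodColl + anis(Φ_t z) ≤ anis(Φ_0 z) + Σ (free-stretch bounds)` (`PathwiseBudget.budget`); drop
`anis(Φ_t z) ≥ 0`, reassemble `Σ_k (1+V_k)⁴ ∫_{I_k} √anis = ∫₀ᵗ (1+v_max(s))⁴ √anis(s) ds` and finish with
Cauchy–Schwarz in `L²[0,t]` (both factors are square integrable on good orbits: `v_max ≤ vR z`, and
`s ↦ anis(Φ_s z)` is integrable on `[0, t]` by `Reduction.integrable_of_bdd`). Constant `max K 0`, threshold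
`N₀` of `FreeStretchBound`. -/
theorem stub_pathwiseBudget : ∀ (γ C : ℝ) (φ : ℕ → T3 → ℝ), 0 < γ → γ ≤ 1 / 15 → AdmissibleKernel γ C φ →
    ∀ σ : ℝ, 0 < σ → σ < 2⁻¹ → FreeStretchBound γ φ σ →
      ∃ K : ℝ, ∃ N₀ : ℕ, ∀ N : ℕ, N₀ ≤ N → ∀ (Φ : Flow σ N) (t : ℝ), 0 ≤ t → ∀ z ∈ Φ.good,
        prodColl σ N Φ φ t z ≤ anisC N φ (Φ.flow 0 z) +
          K * ((N + 1 : ℕ) : ℝ) ^ γ * Real.sqrt (vmaxInt σ N Φ t z) * Real.sqrt (Xint σ N Φ φ t z) := by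
  intro γ C φ _hγ _hγ' hadm σ hσ hσ2 hfs
  obtain ⟨K, N₀, hK⟩ := hfs
  refine ⟨max K 0, N₀, fun N hN Φ t ht z hz => ?_⟩
  have htraj := Φ.isTrajectory z hz
  have hL0 : 0 ≤ max K 0 * ((N + 1 : ℕ) : ℝ) ^ γ := by positivity
  -- the stretch hypothesis at `N`, with the nonnegative constant `max K 0 · (N+1)^γ`
  have hK' : ∀ (w : Cfg N) (T : ℝ), 0 ≤ T →
      (∀ r ∈ Icc 0 T, freeFlight (Torus.geometry (Fin 3)) r w ∈
        hardSphereDomain (Torus.geometry (Fin 3)) (N + 1) (hsDiameter σ N)) →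
      anisC N φ (freeFlight (Torus.geometry (Fin 3)) T w) - anisC N φ w ≤
        max K 0 * ((N + 1 : ℕ) : ℝ) ^ γ * (1 + vmax N w) ^ 4 *
          ∫ r in Icc 0 T, Real.sqrt (anisC N φ (freeFlight (Torus.geometry (Fin 3)) r w)) := by
    intro w T hT hdom
    have hX : 0 ≤ ((N + 1 : ℕ) : ℝ) ^ γ * (1 + vmax N w) ^ 4 *
        ∫ r in Icc 0 T, Real.sqrt (anisC N φ (freeFlight (Torus.geometry (Fin 3)) r w)) :=
      mul_nonneg (mul_nonneg (by positivity) (pow_nonneg (add_nonneg zero_le_one (vmax_nonneg _)) 4))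
        (integral_nonneg fun r => Real.sqrt_nonneg _)
    have h2 := mul_nonneg (sub_nonneg.2 (le_max_left K 0)) hX
    linarith [hK N hN w T hT hdom, h2]
  -- the telescoped budget along the orbit (`budget`, the production summand of `prodColl`)
  have hbud := budget hσ hσ2 htraj
    (g := fun s i j => if i < j then
      anisC N φ (collidePair (Torus.geometry (Fin 3)) i j (Φ.flow s z)) - anisC N φ (Φ.flow s z) else 0)
    (fun s hs => sum_contactPairs_prod hσ hσ2 htraj hs) hK'
    (fun a b ha hab => intervalIntegrable_orbF hadm Φ hz ha hab) _ t ht rfl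
  beta_reduce at hbud
  -- Cauchy–Schwarz in time, and `anis(Φ_t z) ≥ 0`
  have hCS := integral_orbF_le hadm Φ hz t
  have hIcc : ∫ s in (0 : ℝ)..t, (1 + vmax N (Φ.flow s z)) ^ 4 * Real.sqrt (anisC N φ (Φ.flow s z)) =
      ∫ s in Icc 0 t, (1 + vmax N (Φ.flow s z)) ^ 4 * Real.sqrt (anisC N φ (Φ.flow s z)) := by
    rw [intervalIntegral.integral_of_le ht, integral_Icc_eq_integral_Ioc]
  have hpos : 0 ≤ anisC N φ (Φ.flow t z) := anisC_nonneg φ _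
  have h3 := mul_le_mul_of_nonneg_left hCS hL0
  rw [prodColl_eq]
  rw [hIcc] at hbud
  linarith [hbud, h3, hpos]

end

end Summit.AtomisticToContinuum.HydrodynamicLimit.Theorems.ContactBalance
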